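import Literature.MathematicalPhysics.QuantumFieldTheory.Balaban1983to89.Node00.N24NodesWindowStage12C

/-!
# NODE N24 · THE CLOSER'S INTERFACE AT NODE 00's STAGE-12 RECORD: the bodies of crux K1′'s two registered stubs (`stub_nodes12`, `stub_betaWindow12` of plan g64's
# `K1Skeleton12.lean` v2, item stmt-QuantumFields-19903 `StabilityBAtRecordR12e`, route rev 15) and K1′'s CONSEQUENT, from the children STATED AT THE PRESENTATION'S OWN OBJECTS
# (`θ.res.X ∕ Y ∕ Z ∕ W`, `SLaw₁₂ ∕ TLaw₁₂ θ`, `(datumOfRecord₁₂ θ hP).C`, `(datumOfRecord₁₂ θ hP).βfun`) for a world BOUND TO `θ` BY def-T's POINTED EQUATIONS with letters of the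
# closer's choosing — no `∀`-over-presentations socket, no re-lettering, no re-reading

TRACK A (YM-PLAN §2d, node N24 of 28 = binder B2 `hB : B16.EndStatementBPrinted D.C`), seat `pub-ymgap-dag-n24-c` (R134 fan-out seat, strategy s2; gen 2).  TWENTY-SEVENTH N24 module,
a NEW importing one (modules 1–26 untouched; imports module 26 `N24NodesWindowStage12C`).  THEOREMS ONLY, def-free, sorry-free, standard axioms.

WHY.  Modules 23 ∕ 24 ∕ 26 key every carrier child over EVERY presentation `(θ', hP')` of a given record `(D, w)` (the θ-keyed sockets — strength-neutral by module 23 §0's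
iffs, the form a GIVEN record needs).  A CLOSER of `stub_nodes12` works the other way round (V1 ∃-currency, print's «there exist constants»): it CHOOSES a guarded admissible
presentation `θ` (K0′'s product), CHOOSES the world's letters, and must then supply the children AT θ's OWN OBJECTS.  This module is that interface, in kernel form:
§0 a world bound to `θ` with ANY prescribed letters `(γ, e₋, e₊, β⁺, β₀, b, g_R)` exists (def-T's pointed clauses `w.C = (datumOfRecord₁₂ θ hP).C`, `w.L = θ.L`,
`w.up P = upOfRecord₅C (θ.toStage5₁₂) P`; `0 < γ ≤ θ.γ` makes it a ₁₂C record, `isRecordOfRecord₁₂C_of_eq`); §1 at such a world the thirteen nodes follow from: N01 ∕ N02 ∕ N04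
(def-T's transferred theorems), N03 (module 23), **N05** `B8LeafR` at `θ.res.X P`'s [B8] fields, **N06** `B9LeafX (θ.res.Y P)`, **N07** `B11Leaf (θ.res.Z P)`, **N08** the leaf-system
form of `θ.res.X P`'s [B10] runs, **N09** the Lemma-4 leaf `B12Sec2to5.Lemma4Printed (θ.res.X P).F12 (θ.res.X P).c12` + the Theorem-3 member `smallCouplings → smallFieldInductive` at
`(w, P)` (seat dag-n09-d's Stage-12 pointed theorem not in tree — displayed), **N10** the B13 socket at `θ.res`, **N11** the (S1ᵀ) slot at `SLaw₁₂ ∕ TLaw₁₂ θ` (seat dag-n11-e's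
`b14_main_at_record₁₂_of_rOpLeaf`, base `sLaw₁₂_zero` a theorem, 𝐑 from the node's own antecedent), **N12** `B15Leaf (θ.res.W P)`, **N13** the 𝐑-leaf POINTED `∀ P k < K, TLaw₁₂ θ P k →
SLaw₁₂ θ P (k+1)` (`rOperation_upOfRecord₅C_stage12_iff`) + the five [Balaban1988Convergent] Cor.-3 leaves at `((datumOfRecord₁₂ θ hP).C, w.γ)` with the world's OWN exponent
letters `(w.em, w.ep)` (seat dag-n13-a's `B16NodeKnitRecordPinned.b16_main_of_isRecordOfRecord₅C_of_leaf` at the Stage-5 shadow); §2 ∕ §3 the two stubs' bodies and K1′'s rev-15 consequent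
from these pointed children plus the β-box pair on `(datumOfRecord₁₂ θ hP).βfun` along `]0, w.γ]^{k+1}` (module 26 §2: window PRODUCED, interval PACKAGED; lower letter = the
closer's `w.b`, so nothing is re-lettered), also read at the MERGED β over `mergedTermFamilyMatT (TcOfRecord) (chiFixed7 θ.ν)` (module 23 §2, `hD := rfl`).

WHAT THIS FILE PROVES.
§0 `N24_exists_boundWorld₁₂` — a world bound to `(θ, hP)` with prescribed letters.
§1 **`N24_nodes₁₂_pointed`** — `IsRecordOfRecord₁₂C F N (datumOfRecord₁₂ F N θ hP) w ∧ ∀ P, Nodes (leavesP w P)` at a bound world from the POINTED children (list above).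
§2 `N24_nodesAtSomeRecord₁₂_of_pointed` (body of `NodesAtSomeRecord12`, general `N`, guard `hU : θ.ZtUnity F N ∧ θ.SlotsNondegenerate` DISPLAYED);
   **`N24_betaWindowAtSomeRecord₁₂_of_pointed_of_boxH`** (body of `BetaWindowAtSomeRecord12` from the pointed children + `w.b ≤ (datumOfRecord₁₂ θ hP).βfun ≤ w.βup` on `]0, w.γ]^{k+1}`);
   `N24_betaWindowAtSomeRecord₁₂_of_pointed_of_betaMerged` (the same, β read at the merged β of θ).
§3 **`N24_endStatementBPrinted₁₂_pointed`** — (B2) `B16.EndStatementBPrinted (datumOfRecord₁₂ F N θ hP).C` from the pointed children + the β-box pair (def-T's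
   `endStatementBPrinted_of_isRecordOfRecord₁₂C_of_nodes`); **`N24_stabilityBR12e_thetaShape15_pointed`** — K1′'s rev-15 CONSEQUENT `∃ θ' h', (θ'.ZtUnity ∧ θ'.SlotsNondegenerate) ∧
   θ'.Admissible ∧ (B)(datumOfRecord₁₂ θ' h').C ∧ window` witnessed by `(θ, hP)`.

WHICH CHILD BLOCKS (closer's form, kernel = §1's hypothesis list at θ's own objects): N05 [B8] residual leaf · N06 def-Y's leaf · N07 [B11] leaf · N08 leaf-system form of the [B10]
runs · N09 Lemma-4 leaf + Theorem-3 member · N10 B13 socket · N11 (S1ᵀ) · N12 [IV] leaf · N13 𝐑-leaf (pointed) + Cor.-3 ×5 at the world's own `(e₋, e₊)` · the guard and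
`Provisos₁₂ ∧ Admissible` of the chosen θ = K0′ `Record12Inhabited` (stmt-QuantumFields-19902) · β upper ([I] (1.22) p. 264) + β lower `b > 0` (UNPRINTED, T09.F = NODE O) for
`stub_betaWindow12` ∕ (B2).  HONEST FRAMING: kernel bookkeeping BY NAME; nothing of Bałaban's asserted; every slot DISPLAYED; N24 COMPOSITE — no discharge, no count, no stub
closed; one finite T⁴ programme at fixed ε; NOT continuum ∕ ℝ⁴ ∕ OS ∕ mass gap ∕ Clay.
-/

noncomputable section

open scoped Matrix.Norms.L2Operator

namespace Literature.MathematicalPhysics.QuantumFieldTheory.Balaban1983to89.Node00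

open DagBinding T4Continuum T4DatumAssembly FlowStepRuns AveragingRT
open FlowStep (BetaLowerH BetaUpperH)

variable {F : T4Family} {N : ℕ} [NeZero N]

/-! ## §0. A world bound to the presentation with prescribed letters -/

/-- **A WORLD BOUND TO `(θ, hP)` BY def-T's POINTED CLAUSES WITH ANY PRESCRIBED LETTERS** — construction `(datumOfRecord₁₂ θ hP).C`, block size `θ.L`, upstream blocks the
C-binding of record over the Stage-12 view, and the letters `(γ, e₋, e₊, β⁺, β₀, b, g_R)` as given (`b, β₀ > 0`).  With `0 < γ ≤ θ.γ` it is a ₁₂C record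
(`isRecordOfRecord₁₂C_of_eq`); the letters are the closer's «there exist constants». [cite: Balaban1989LargeFieldII, Thm 1 + (0.1) pp.355–356; Balaban1988Convergent, Cor. 3 (2.50) p.264; Balaban1987RG1, Thm 2 p.259 (the letters' printed homes; bookkeeping)] -/
theorem N24_exists_boundWorld₁₂ (θ : Stage12Params F N) (hP : θ.Provisos₁₂ F N) (γw : ℝ) (em ep : ℝ → ℝ) (βup : ℝ) {β₀ b : ℝ} (hβ₀ : 0 < β₀) (hb : 0 < b)
    (gR : ℝ) :
    ∃ w : WorldP, w.C = (datumOfRecord₁₂ F N θ hP).C ∧ w.γ = γw ∧ w.L = (θ.L : ℝ) ∧ (∀ P, w.up P = upOfRecord₅C F N (θ.toStage5₁₂ F N) P) ∧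
      w.em = em ∧ w.ep = ep ∧ w.βup = βup ∧ w.β₀ = β₀ ∧ w.b = b ∧ w.gR = gR :=
  ⟨⟨(datumOfRecord₁₂ F N θ hP).C, γw, em, ep, βup, β₀, hβ₀, b, hb, (θ.L : ℝ), by exact_mod_cast θ.hL.2, gR,
      fun P => upOfRecord₅C F N (θ.toStage5₁₂ F N) P⟩,
    rfl, rfl, rfl, fun _ => rfl, rfl, rfl, rfl, rfl, rfl, rfl⟩

/-! ## §1. The thirteen nodes at a bound world from the POINTED children -/

/-- **N24 · THE THIRTEEN DAG NODES AT A WORLD BOUND TO THE PRESENTATION, FROM THE CHILDREN AT THE PRESENTATION'S OWN OBJECTS.**  A world `w` bound to `(θ, hP)` (`hC`, `hγ`,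
`hL`, `hup` — def-T's pointed clauses; it IS then a ₁₂C record over `datumOfRecord₁₂ θ hP`), and: **N05** `B8LeafR` at the [B8] fields of `θ.res.X P` ([Balaban1985RegularSpaces]
Lemma 1 – Thm 8, `B8LeafKnit.b8_main_of_leaf`); **N06** `B9LeafX (θ.res.Y P)` (in-edges unused); **N07** `B11Leaf (θ.res.Z P)` (`B11LeafUnpinnedRecord.b11_main_of_upOfRecord₅C_of_b11Leaf`);
**N08** the residual [B10] run family of `θ.res.X P` presented as leaf-system tower runs ([Balaban1985UV3] compact reading, `B10LeafUnpinnedRecord5C.b10_main_of_upOfRecord₅C_of_leafSystems`);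
**N09** its own leaf — [Balaban1987RG1] Lemma 4 (3.53) `B12Sec2to5.Lemma4Printed (θ.res.X P).F12 (θ.res.X P).c12` — and its Theorem-3 member `smallCouplings → smallFieldInductive` at
`(w, P)` (`B12NodeKnitRecord8.b12_main_of_leaf_of_thm3Member`; seat dag-n09-d's Stage-12 pointed closer of the member from [B11] Thm 1 at the record's objects is not in the tree —
DISPLAYED); **N10** [Balaban1988RG2Cluster] Lemmas 1–3 at `θ.res` given the in-edge leaves (`B13NodeKnitRecord5C.b13_main_at_stage5ParamsC`); **N11** the (S1ᵀ) slot at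
`SLaw₁₂ ∕ TLaw₁₂ θ` (seat dag-n11-e's `B14NodeKnitRecord12R.b14_main_at_record₁₂_of_rOpLeaf`: base `sLaw₁₂_zero` a theorem of the record, 𝐑 from the node's own antecedent through
`rOperation_iff_rOpLeaf₁₂`); **N12** `B15Leaf (θ.res.W P)` (`B15LeafKnit.b15_main_of_up`); **N13** the 𝐑-leaf POINTED — «𝐓-image form ⇒ §2 form one level up» `∀ P k < K, TLaw₁₂ θ P k →
SLaw₁₂ θ P (k+1)` (`rOperation_upOfRecord₅C_stage12_iff`, repaired format) — and the five [Balaban1988Convergent] Cor.-3 leaves for SOME representation family `R` at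
`((datumOfRecord₁₂ θ hP).C, w.γ)` with the world's OWN exponent functions `(w.em, w.ep)` (seat dag-n13-a's `B16NodeKnitRecordPinned.b16_main_of_isRecordOfRecord₅C_of_leaf` at the
Stage-5 shadow `exists_isRecordOfRecord₅C_of_isRecordOfRecord₁₂C`, `D₅.C = D.C` consumed); **N01 ∕ N02 ∕ N04** def-T's transferred theorems, **N03** module 23's — give
`IsRecordOfRecord₁₂C F N (datumOfRecord₁₂ F N θ hP) w ∧ ∀ P, Nodes (leavesP w P)`.  THE HYPOTHESIS LIST IS «WHICH CHILD BLOCKS `stub_nodes12`» IN THE CLOSER'S (pointed) FORM.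
[cite: Balaban1989LargeFieldII, Thm 1 p.355, (0.1) pp.355–356, p.387, p.391; Balaban1988Convergent, Thm 1 p.262, Theorem p.245, p.244, Cor. 3 (2.50) p.264 and pp.283–284; Balaban1987RG1, Thm 1 p.259, Thm 3 p.264, Lemma 4 (3.53) p.280; Balaban1985RegularSpaces, Thms 2, 4, 8 pp.83–101; Balaban1985BackgroundPropagators, Thms 3.1–3.15 pp.397–432; Balaban1985Variational, Thm 1 p.279; Balaban1985UV3, Thm 1 p.257 + Thm 2 p.272; Balaban1988RG2Cluster, Lemmas 1–3 pp.9, 11, 20; Balaban1989LargeFieldI, Prop. 1 p.194; Balaban1983RegularityDecay, Theorem p.573; Balaban1984PropagatorsI, Props. 1.1–1.2 pp.33–36; Balaban1984PropagatorsII, pp.234–249; Balaban1985Averaging, Props. 1–10 pp.26–50 (node bookkeeping at the presentation's own objects)] -/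
theorem N24_nodes₁₂_pointed (θ : Stage12Params F N) (hP : θ.Provisos₁₂ F N) (hθ : θ.Admissible F N) (w : WorldP)
    (hC : w.C = (datumOfRecord₁₂ F N θ hP).C) (hγ : 0 < w.γ ∧ w.γ ≤ θ.γ) (hL : w.L = (θ.L : ℝ))
    (hup : ∀ P, w.up P = upOfRecord₅C F N (θ.toStage5₁₂ F N) P)
    (h05 : ∀ P : B12.RunParams,
      B8LeafR (θ.res.X P).d8 (θ.res.X P).L8 (θ.res.X P).C₂ (θ.res.X P).B₁' (θ.res.X P).B₀' (θ.res.X P).B₁ (θ.res.X P).B₂ (θ.res.X P).c₁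
        (θ.res.X P).inp8 (θ.res.X P).B₀β (θ.res.X P).loc8 (θ.res.X P).fam8R (θ.res.X P).lan8 (θ.res.X P).cub8 (θ.res.X P).toAxial8)
    (h06 : ∀ P : B12.RunParams, B9LeafX (θ.res.Y P))
    (h07 : ∀ P : B12.RunParams, B11Leaf (θ.res.Z P))
    (h08 : ∀ P : B12.RunParams, ∃ (Xc : PrintedCarriersR) (I : Type) (C : B10Assembly.Consts) (T : I → B10.TowerRun),
      Nonempty (∀ i, B10Assembly.LeafSystem C (T i)) ∧ θ.res.X P = Xc.withTowerRuns10 T)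
    (h09 : ∀ P : B12.RunParams, B12Sec2to5.Lemma4Printed (θ.res.X P).F12 (θ.res.X P).c12)
    (h09T : ∀ P : B12.RunParams, (leavesP w P).smallCouplings → (leavesP w P).smallFieldInductive)
    (h10 : ∀ P : B12.RunParams, B9LeafX (θ.res.Y P) →
      (B10.Thm1PrintedCompact (θ.res.X P).runs10 ∧ B10.Thm2Printed (θ.res.X P).runs10) →
        B11Leaf (θ.res.Z P) → B12Sec2to5.Lemma4Printed (θ.res.X P).F12 (θ.res.X P).c12 →
          B13.Lemma1Printed (θ.res.X P).S13 (θ.res.X P).c13 ∧ B13.Lemma2Printed (θ.res.X P).S13 (θ.res.X P).c13 ∧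
            B13.Lemma3Printed (θ.res.X P).S13 (θ.res.X P).c13)
    (h11 : ∀ P : B12.RunParams, (leavesP w P).b7 → (leavesP w P).b8 → (leavesP w P).b9 → (leavesP w P).b10 → (leavesP w P).b11 →
      (leavesP w P).smallCouplings → (leavesP w P).smallFieldInductive → (leavesP w P).flowControl →
        ∀ k, k < P.K → SLaw₁₂ F N θ P k → TLaw₁₂ F N θ P k)
    (h12 : ∀ P : B12.RunParams, B15Leaf (θ.res.W P))
    (hR : ∀ (P : B12.RunParams) (k : ℕ), k < P.K → TLaw₁₂ F N θ P k → SLaw₁₂ F N θ P (k + 1))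
    (hcor3 : ∃ R : B14Cor3.ReprFamily (datumOfRecord₁₂ F N θ hP).C,
      B14Cor3.LeafH (datumOfRecord₁₂ F N θ hP).C R w.γ ∧ B14Cor3.LeafU1 (datumOfRecord₁₂ F N θ hP).C R w.γ ∧
        B14Cor3.LeafU2 (datumOfRecord₁₂ F N θ hP).C R w.γ w.ep ∧ B14Cor3.LeafL1 (datumOfRecord₁₂ F N θ hP).C R w.γ ∧
          B14Cor3.LeafL2 (datumOfRecord₁₂ F N θ hP).C R w.γ w.em) :
    IsRecordOfRecord₁₂C F N (datumOfRecord₁₂ F N θ hP) w ∧ ∀ P : B12.RunParams, Nodes (leavesP w P) := by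
  have hrec : IsRecordOfRecord₁₂C F N (datumOfRecord₁₂ F N θ hP) w := ⟨θ, hP, hθ, rfl, hC, hγ, hL, hup⟩
  obtain ⟨D₅, h₅, hC5, -⟩ := exists_isRecordOfRecord₅C_of_isRecordOfRecord₁₂C hrec
  rw [← hC5] at hcor3
  obtain ⟨R, hH, hU1, hU2, hL1, hL2⟩ := hcor3
  have hRw : ∀ P : B12.RunParams, (w.up P).rOperation := fun P => by
    rw [hup P]; exact (rOperation_upOfRecord₅C_stage12_iff F N θ P).2 (hR P)
  have h16 := B16NodeKnitRecordPinned.b16_main_of_isRecordOfRecord₅C_of_leaf h₅ hRw R hH hU1 hU2 hL1 hL2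
  refine ⟨hrec, fun P => ?_⟩
  have hl := B11LeafUnpinnedRecord.upOfRecord₅C_b8_b9_b11 (θ.toStage5₁₂ F N) P
  have h8 : (w.up P).b8 := by rw [hup P]; exact hl.1.2 (h05 P)
  have h9 : (w.up P).b9 := by rw [hup P]; exact hl.2.1.2 (h06 P)
  have h15 : (w.up P).rBasicStep := by
    rw [hup P]; exact (B15LeafKnitRecord7.rBasicStep_upOfRecord₅C_iff (θ.toStage5₁₂ F N) P).2 (h12 P)
  have h12leaf : (leavesP w P).b12 := by
    show (w.up P).b12
    rw [hup P]; exact h09 P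
  obtain ⟨Xc, I, C, T, ⟨S⟩, hX⟩ := h08 P
  exact ⟨b4_main_of_isRecordOfRecord₁₂C hrec P, b5_main_of_isRecordOfRecord₁₂C hrec P, N24_b6_main_of_isRecordOfRecord₁₂C hrec P,
    b7_main_of_isRecordOfRecord₁₂C hrec P, B8LeafKnit.b8_main_of_leaf w P h8, fun _ _ _ _ => h9,
    B10LeafUnpinnedRecord5C.b10_main_of_upOfRecord₅C_of_leafSystems (θ.toStage5₁₂ F N) (hup P) Xc S hX,
    B11LeafUnpinnedRecord.b11_main_of_upOfRecord₅C_of_b11Leaf (θ.toStage5₁₂ F N) P (hup P) (h07 P),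
    B12NodeKnitRecord8.b12_main_of_leaf_of_thm3Member h12leaf (h09T P),
    B13NodeKnitRecord5C.b13_main_at_stage5ParamsC F N (θ.toStage5₁₂ F N) w P (hup P) (h10 P),
    B14NodeKnitRecord12R.b14_main_at_record₁₂_of_rOpLeaf F N θ hP w P hC
      (B14NodeKnitRecord12R.rOperation_iff_rOpLeaf₁₂ F N θ w P (hup P)).1 (h11 P),
    B15LeafKnit.b15_main_of_up (U := w.up P) rfl h15, h16 P⟩

/-! ## §2. The two stubs' bodies from the pointed children (guard displayed, threaded, never produced) -/

/-- **THE BODY OF `NodesAtSomeRecord12` FROM THE POINTED CHILDREN** (general `N`; at `N := 2` plan g64's text): a guarded admissible presentation `(θ, hP)` (`hU` — DISPLAYED, a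
hypothesis of the crux's own antecedent K0′ `Record12Inhabited`), a world bound to it and §1's pointed children give `∃ θ' h' w', (θ'.ZtUnity ∧ θ'.SlotsNondegenerate) ∧ θ'.Admissible ∧
IsRecordOfRecord₁₂C F N (datumOfRecord₁₂ F N θ' h') w' ∧ ∀ P, Nodes (leavesP w' P)` — witnesses `(θ, hP, w)` themselves.  COMPOSITE: nothing is discharged.
[cite: Balaban1989LargeFieldII, Thm 1 p.355 + p.391; Balaban1988Convergent, (3.16)–(3.22) pp.268–269 (bookkeeping)] -/
theorem N24_nodesAtSomeRecord₁₂_of_pointed (θ : Stage12Params F N) (hP : θ.Provisos₁₂ F N) (hθ : θ.Admissible F N)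
    (hU : θ.ZtUnity F N ∧ θ.SlotsNondegenerate) (w : WorldP)
    (hC : w.C = (datumOfRecord₁₂ F N θ hP).C) (hγ : 0 < w.γ ∧ w.γ ≤ θ.γ) (hL : w.L = (θ.L : ℝ))
    (hup : ∀ P, w.up P = upOfRecord₅C F N (θ.toStage5₁₂ F N) P)
    (h05 : ∀ P : B12.RunParams,
      B8LeafR (θ.res.X P).d8 (θ.res.X P).L8 (θ.res.X P).C₂ (θ.res.X P).B₁' (θ.res.X P).B₀' (θ.res.X P).B₁ (θ.res.X P).B₂ (θ.res.X P).c₁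
        (θ.res.X P).inp8 (θ.res.X P).B₀β (θ.res.X P).loc8 (θ.res.X P).fam8R (θ.res.X P).lan8 (θ.res.X P).cub8 (θ.res.X P).toAxial8)
    (h06 : ∀ P : B12.RunParams, B9LeafX (θ.res.Y P))
    (h07 : ∀ P : B12.RunParams, B11Leaf (θ.res.Z P))
    (h08 : ∀ P : B12.RunParams, ∃ (Xc : PrintedCarriersR) (I : Type) (C : B10Assembly.Consts) (T : I → B10.TowerRun),
      Nonempty (∀ i, B10Assembly.LeafSystem C (T i)) ∧ θ.res.X P = Xc.withTowerRuns10 T)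
    (h09 : ∀ P : B12.RunParams, B12Sec2to5.Lemma4Printed (θ.res.X P).F12 (θ.res.X P).c12)
    (h09T : ∀ P : B12.RunParams, (leavesP w P).smallCouplings → (leavesP w P).smallFieldInductive)
    (h10 : ∀ P : B12.RunParams, B9LeafX (θ.res.Y P) →
      (B10.Thm1PrintedCompact (θ.res.X P).runs10 ∧ B10.Thm2Printed (θ.res.X P).runs10) →
        B11Leaf (θ.res.Z P) → B12Sec2to5.Lemma4Printed (θ.res.X P).F12 (θ.res.X P).c12 →
          B13.Lemma1Printed (θ.res.X P).S13 (θ.res.X P).c13 ∧ B13.Lemma2Printed (θ.res.X P).S13 (θ.res.X P).c13 ∧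
            B13.Lemma3Printed (θ.res.X P).S13 (θ.res.X P).c13)
    (h11 : ∀ P : B12.RunParams, (leavesP w P).b7 → (leavesP w P).b8 → (leavesP w P).b9 → (leavesP w P).b10 → (leavesP w P).b11 →
      (leavesP w P).smallCouplings → (leavesP w P).smallFieldInductive → (leavesP w P).flowControl →
        ∀ k, k < P.K → SLaw₁₂ F N θ P k → TLaw₁₂ F N θ P k)
    (h12 : ∀ P : B12.RunParams, B15Leaf (θ.res.W P))
    (hR : ∀ (P : B12.RunParams) (k : ℕ), k < P.K → TLaw₁₂ F N θ P k → SLaw₁₂ F N θ P (k + 1))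
    (hcor3 : ∃ R : B14Cor3.ReprFamily (datumOfRecord₁₂ F N θ hP).C,
      B14Cor3.LeafH (datumOfRecord₁₂ F N θ hP).C R w.γ ∧ B14Cor3.LeafU1 (datumOfRecord₁₂ F N θ hP).C R w.γ ∧
        B14Cor3.LeafU2 (datumOfRecord₁₂ F N θ hP).C R w.γ w.ep ∧ B14Cor3.LeafL1 (datumOfRecord₁₂ F N θ hP).C R w.γ ∧
          B14Cor3.LeafL2 (datumOfRecord₁₂ F N θ hP).C R w.γ w.em) :
    ∃ (θ' : Stage12Params F N) (h' : θ'.Provisos₁₂ F N) (w' : WorldP), (θ'.ZtUnity F N ∧ θ'.SlotsNondegenerate) ∧ θ'.Admissible F N ∧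
      IsRecordOfRecord₁₂C F N (datumOfRecord₁₂ F N θ' h') w' ∧ ∀ P : B12.RunParams, Nodes (leavesP w' P) := by
  obtain ⟨hrec, hn⟩ := N24_nodes₁₂_pointed θ hP hθ w hC hγ hL hup h05 h06 h07 h08 h09 h09T h10 h11 h12 hR hcor3
  exact ⟨θ, hP, w, hU, hθ, hrec, hn⟩

/-- **THE BODY OF `BetaWindowAtSomeRecord12` FROM THE POINTED CHILDREN AND THE β-BOX PAIR** (general `N`; at `N := 2` plan g64's text): as `N24_nodesAtSomeRecord₁₂_of_pointed`, plus
`w.b ≤ (datumOfRecord₁₂ θ hP).βfun ≤ w.βup` on the world's own box `]0, w.γ]^{k+1}` (upper: [Balaban1987RG1] (1.22) p. 264, proof deferred in print; lower with `w.b > 0`: UNPRINTED, T09.F =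
NODE O) ⇒ additionally `BetaBoundsInInterval w'.C.toB12 w'.γ w'.b w'.βup` and the crux's window (module 26 §2) — witnesses `(θ, hP, w)` themselves: the lower letter IS the closer's `w.b`.
[cite: Balaban1987RG1, §1 (1.22) p.264, Thm 2 p.259, (0.17)–(0.20) pp.255–256; Balaban1989LargeFieldII, Thm 1 p.355 (bookkeeping)] -/
theorem N24_betaWindowAtSomeRecord₁₂_of_pointed_of_boxH (θ : Stage12Params F N) (hP : θ.Provisos₁₂ F N) (hθ : θ.Admissible F N)
    (hU : θ.ZtUnity F N ∧ θ.SlotsNondegenerate) (w : WorldP)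
    (hC : w.C = (datumOfRecord₁₂ F N θ hP).C) (hγ : 0 < w.γ ∧ w.γ ≤ θ.γ) (hL : w.L = (θ.L : ℝ))
    (hup : ∀ P, w.up P = upOfRecord₅C F N (θ.toStage5₁₂ F N) P)
    (h05 : ∀ P : B12.RunParams,
      B8LeafR (θ.res.X P).d8 (θ.res.X P).L8 (θ.res.X P).C₂ (θ.res.X P).B₁' (θ.res.X P).B₀' (θ.res.X P).B₁ (θ.res.X P).B₂ (θ.res.X P).c₁
        (θ.res.X P).inp8 (θ.res.X P).B₀β (θ.res.X P).loc8 (θ.res.X P).fam8R (θ.res.X P).lan8 (θ.res.X P).cub8 (θ.res.X P).toAxial8)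
    (h06 : ∀ P : B12.RunParams, B9LeafX (θ.res.Y P))
    (h07 : ∀ P : B12.RunParams, B11Leaf (θ.res.Z P))
    (h08 : ∀ P : B12.RunParams, ∃ (Xc : PrintedCarriersR) (I : Type) (C : B10Assembly.Consts) (T : I → B10.TowerRun),
      Nonempty (∀ i, B10Assembly.LeafSystem C (T i)) ∧ θ.res.X P = Xc.withTowerRuns10 T)
    (h09 : ∀ P : B12.RunParams, B12Sec2to5.Lemma4Printed (θ.res.X P).F12 (θ.res.X P).c12)
    (h09T : ∀ P : B12.RunParams, (leavesP w P).smallCouplings → (leavesP w P).smallFieldInductive)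
    (h10 : ∀ P : B12.RunParams, B9LeafX (θ.res.Y P) →
      (B10.Thm1PrintedCompact (θ.res.X P).runs10 ∧ B10.Thm2Printed (θ.res.X P).runs10) →
        B11Leaf (θ.res.Z P) → B12Sec2to5.Lemma4Printed (θ.res.X P).F12 (θ.res.X P).c12 →
          B13.Lemma1Printed (θ.res.X P).S13 (θ.res.X P).c13 ∧ B13.Lemma2Printed (θ.res.X P).S13 (θ.res.X P).c13 ∧
            B13.Lemma3Printed (θ.res.X P).S13 (θ.res.X P).c13)
    (h11 : ∀ P : B12.RunParams, (leavesP w P).b7 → (leavesP w P).b8 → (leavesP w P).b9 → (leavesP w P).b10 → (leavesP w P).b11 →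
      (leavesP w P).smallCouplings → (leavesP w P).smallFieldInductive → (leavesP w P).flowControl →
        ∀ k, k < P.K → SLaw₁₂ F N θ P k → TLaw₁₂ F N θ P k)
    (h12 : ∀ P : B12.RunParams, B15Leaf (θ.res.W P))
    (hR : ∀ (P : B12.RunParams) (k : ℕ), k < P.K → TLaw₁₂ F N θ P k → SLaw₁₂ F N θ P (k + 1))
    (hcor3 : ∃ R : B14Cor3.ReprFamily (datumOfRecord₁₂ F N θ hP).C,
      B14Cor3.LeafH (datumOfRecord₁₂ F N θ hP).C R w.γ ∧ B14Cor3.LeafU1 (datumOfRecord₁₂ F N θ hP).C R w.γ ∧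
        B14Cor3.LeafU2 (datumOfRecord₁₂ F N θ hP).C R w.γ w.ep ∧ B14Cor3.LeafL1 (datumOfRecord₁₂ F N θ hP).C R w.γ ∧
          B14Cor3.LeafL2 (datumOfRecord₁₂ F N θ hP).C R w.γ w.em)
    (hlo : BetaLowerH w.b w.γ (datumOfRecord₁₂ F N θ hP).βfun) (hhi : BetaUpperH w.βup w.γ (datumOfRecord₁₂ F N θ hP).βfun) :
    ∃ (θ' : Stage12Params F N) (h' : θ'.Provisos₁₂ F N) (w' : WorldP), (θ'.ZtUnity F N ∧ θ'.SlotsNondegenerate) ∧ θ'.Admissible F N ∧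
      IsRecordOfRecord₁₂C F N (datumOfRecord₁₂ F N θ' h') w' ∧ (∀ P : B12.RunParams, Nodes (leavesP w' P)) ∧
      BetaBoundsInInterval w'.C.toB12 w'.γ w'.b w'.βup ∧
      ∃ γ₁ : ℝ, 0 < γ₁ ∧ ∀ γ : ℝ, 0 < γ → γ ≤ γ₁ → ∃ P : B12.RunParams, 1 ≤ P.K ∧ ((datumOfRecord₁₂ F N θ' h').C P).flow.InInterval γ P.K := by
  obtain ⟨hrec, hn⟩ := N24_nodes₁₂_pointed θ hP hθ w hC hγ hL hup h05 h06 h07 h08 h09 h09T h10 h11 h12 hR hcor3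
  exact ⟨θ, hP, w, hU, hθ, hrec, hn, N24_betaBoundsInInterval_of_isRecordOfRecord₁₂C_of_boxH hrec hlo hhi,
    N24_window_of_betaUpperH _ hγ.1 hhi⟩

/-- **The same with the β-box pair READ AT THE MERGED β OF THE PRESENTATION** — `β_merged = betaMerged F (mergedTermFamilyMatT F N (TcOfRecord F N) (chiFixed7 F N θ.ν) θ.εbg) θ.ρ8 θ.bV`,
the presentation's own version-free object; `(datumOfRecord₁₂ θ hP).βfun` agrees with it on `]0, w.γ]^{k+1} ⊆ ]0, θ.γ]^{k+1}` (module 23 §2's iffs at `hD := rfl`).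
[cite: Balaban1987RG1, (0.19) p.255, (1.20)–(1.22) p.264, (2.12)–(2.14) p.268, Thm 2 p.259; Balaban1989LargeFieldII, Thm 1 p.355 (bookkeeping)] -/
theorem N24_betaWindowAtSomeRecord₁₂_of_pointed_of_betaMerged (θ : Stage12Params F N) (hP : θ.Provisos₁₂ F N) (hθ : θ.Admissible F N)
    (hU : θ.ZtUnity F N ∧ θ.SlotsNondegenerate) (w : WorldP)
    (hC : w.C = (datumOfRecord₁₂ F N θ hP).C) (hγ : 0 < w.γ ∧ w.γ ≤ θ.γ) (hL : w.L = (θ.L : ℝ))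
    (hup : ∀ P, w.up P = upOfRecord₅C F N (θ.toStage5₁₂ F N) P)
    (h05 : ∀ P : B12.RunParams,
      B8LeafR (θ.res.X P).d8 (θ.res.X P).L8 (θ.res.X P).C₂ (θ.res.X P).B₁' (θ.res.X P).B₀' (θ.res.X P).B₁ (θ.res.X P).B₂ (θ.res.X P).c₁
        (θ.res.X P).inp8 (θ.res.X P).B₀β (θ.res.X P).loc8 (θ.res.X P).fam8R (θ.res.X P).lan8 (θ.res.X P).cub8 (θ.res.X P).toAxial8)
    (h06 : ∀ P : B12.RunParams, B9LeafX (θ.res.Y P))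
    (h07 : ∀ P : B12.RunParams, B11Leaf (θ.res.Z P))
    (h08 : ∀ P : B12.RunParams, ∃ (Xc : PrintedCarriersR) (I : Type) (C : B10Assembly.Consts) (T : I → B10.TowerRun),
      Nonempty (∀ i, B10Assembly.LeafSystem C (T i)) ∧ θ.res.X P = Xc.withTowerRuns10 T)
    (h09 : ∀ P : B12.RunParams, B12Sec2to5.Lemma4Printed (θ.res.X P).F12 (θ.res.X P).c12)
    (h09T : ∀ P : B12.RunParams, (leavesP w P).smallCouplings → (leavesP w P).smallFieldInductive)
    (h10 : ∀ P : B12.RunParams, B9LeafX (θ.res.Y P) →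
      (B10.Thm1PrintedCompact (θ.res.X P).runs10 ∧ B10.Thm2Printed (θ.res.X P).runs10) →
        B11Leaf (θ.res.Z P) → B12Sec2to5.Lemma4Printed (θ.res.X P).F12 (θ.res.X P).c12 →
          B13.Lemma1Printed (θ.res.X P).S13 (θ.res.X P).c13 ∧ B13.Lemma2Printed (θ.res.X P).S13 (θ.res.X P).c13 ∧
            B13.Lemma3Printed (θ.res.X P).S13 (θ.res.X P).c13)
    (h11 : ∀ P : B12.RunParams, (leavesP w P).b7 → (leavesP w P).b8 → (leavesP w P).b9 → (leavesP w P).b10 → (leavesP w P).b11 →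
      (leavesP w P).smallCouplings → (leavesP w P).smallFieldInductive → (leavesP w P).flowControl →
        ∀ k, k < P.K → SLaw₁₂ F N θ P k → TLaw₁₂ F N θ P k)
    (h12 : ∀ P : B12.RunParams, B15Leaf (θ.res.W P))
    (hR : ∀ (P : B12.RunParams) (k : ℕ), k < P.K → TLaw₁₂ F N θ P k → SLaw₁₂ F N θ P (k + 1))
    (hcor3 : ∃ R : B14Cor3.ReprFamily (datumOfRecord₁₂ F N θ hP).C,
      B14Cor3.LeafH (datumOfRecord₁₂ F N θ hP).C R w.γ ∧ B14Cor3.LeafU1 (datumOfRecord₁₂ F N θ hP).C R w.γ ∧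
        B14Cor3.LeafU2 (datumOfRecord₁₂ F N θ hP).C R w.γ w.ep ∧ B14Cor3.LeafL1 (datumOfRecord₁₂ F N θ hP).C R w.γ ∧
          B14Cor3.LeafL2 (datumOfRecord₁₂ F N θ hP).C R w.γ w.em)
    (hlo : letI := θ.instVβ₁; letI := θ.instVβ₂; letI := θ.instιβ
      BetaLowerH w.b w.γ (betaMerged F (mergedTermFamilyMatT F N (TcOfRecord F N) (chiFixed7 F N θ.ν) θ.εbg) θ.ρ8 θ.bV))
    (hhi : letI := θ.instVβ₁; letI := θ.instVβ₂; letI := θ.instιβ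
      BetaUpperH w.βup w.γ (betaMerged F (mergedTermFamilyMatT F N (TcOfRecord F N) (chiFixed7 F N θ.ν) θ.εbg) θ.ρ8 θ.bV)) :
    ∃ (θ' : Stage12Params F N) (h' : θ'.Provisos₁₂ F N) (w' : WorldP), (θ'.ZtUnity F N ∧ θ'.SlotsNondegenerate) ∧ θ'.Admissible F N ∧
      IsRecordOfRecord₁₂C F N (datumOfRecord₁₂ F N θ' h') w' ∧ (∀ P : B12.RunParams, Nodes (leavesP w' P)) ∧
      BetaBoundsInInterval w'.C.toB12 w'.γ w'.b w'.βup ∧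
      ∃ γ₁ : ℝ, 0 < γ₁ ∧ ∀ γ : ℝ, 0 < γ → γ ≤ γ₁ → ∃ P : B12.RunParams, 1 ≤ P.K ∧ ((datumOfRecord₁₂ F N θ' h').C P).flow.InInterval γ P.K :=
  N24_betaWindowAtSomeRecord₁₂_of_pointed_of_boxH θ hP hθ hU w hC hγ hL hup h05 h06 h07 h08 h09 h09T h10 h11 h12 hR hcor3
    ((N24_betaLowerH_iff_merged₁₂ θ hP rfl hγ.2).mpr hlo) ((N24_betaUpperH_iff_merged₁₂ θ hP rfl hγ.2).mpr hhi)

/-! ## §3. (B2) and K1′'s rev-15 consequent from the pointed children and the β-box pair -/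

/-- **N24 · (B2) AT THE PRESENTATION'S DATUM FROM THE POINTED CHILDREN AND THE β-BOX PAIR**: `B16.EndStatementBPrinted (datumOfRecord₁₂ F N θ hP).C` — §1's nodes at the bound
world, the interval β-binder from `w.b ≤ (datumOfRecord₁₂ θ hP).βfun ≤ w.βup` on `]0, w.γ]^{k+1}` (module 26 §2), def-T's END headline `endStatementBPrinted_of_isRecordOfRecord₁₂C_of_nodes`
(`γ₀ := w.γ`).  COMPOSITE: (B2) GIVEN the children; nothing is discharged. [cite: Balaban1989LargeFieldII, Thm 1 p.355, (0.1) pp.355–356, p.391; Balaban1987RG1, (1.22) p.264 (bookkeeping at the presentation's own objects)] -/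
theorem N24_endStatementBPrinted₁₂_pointed (θ : Stage12Params F N) (hP : θ.Provisos₁₂ F N) (hθ : θ.Admissible F N) (w : WorldP)
    (hC : w.C = (datumOfRecord₁₂ F N θ hP).C) (hγ : 0 < w.γ ∧ w.γ ≤ θ.γ) (hL : w.L = (θ.L : ℝ))
    (hup : ∀ P, w.up P = upOfRecord₅C F N (θ.toStage5₁₂ F N) P)
    (h05 : ∀ P : B12.RunParams,
      B8LeafR (θ.res.X P).d8 (θ.res.X P).L8 (θ.res.X P).C₂ (θ.res.X P).B₁' (θ.res.X P).B₀' (θ.res.X P).B₁ (θ.res.X P).B₂ (θ.res.X P).c₁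
        (θ.res.X P).inp8 (θ.res.X P).B₀β (θ.res.X P).loc8 (θ.res.X P).fam8R (θ.res.X P).lan8 (θ.res.X P).cub8 (θ.res.X P).toAxial8)
    (h06 : ∀ P : B12.RunParams, B9LeafX (θ.res.Y P))
    (h07 : ∀ P : B12.RunParams, B11Leaf (θ.res.Z P))
    (h08 : ∀ P : B12.RunParams, ∃ (Xc : PrintedCarriersR) (I : Type) (C : B10Assembly.Consts) (T : I → B10.TowerRun),
      Nonempty (∀ i, B10Assembly.LeafSystem C (T i)) ∧ θ.res.X P = Xc.withTowerRuns10 T)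
    (h09 : ∀ P : B12.RunParams, B12Sec2to5.Lemma4Printed (θ.res.X P).F12 (θ.res.X P).c12)
    (h09T : ∀ P : B12.RunParams, (leavesP w P).smallCouplings → (leavesP w P).smallFieldInductive)
    (h10 : ∀ P : B12.RunParams, B9LeafX (θ.res.Y P) →
      (B10.Thm1PrintedCompact (θ.res.X P).runs10 ∧ B10.Thm2Printed (θ.res.X P).runs10) →
        B11Leaf (θ.res.Z P) → B12Sec2to5.Lemma4Printed (θ.res.X P).F12 (θ.res.X P).c12 →
          B13.Lemma1Printed (θ.res.X P).S13 (θ.res.X P).c13 ∧ B13.Lemma2Printed (θ.res.X P).S13 (θ.res.X P).c13 ∧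
            B13.Lemma3Printed (θ.res.X P).S13 (θ.res.X P).c13)
    (h11 : ∀ P : B12.RunParams, (leavesP w P).b7 → (leavesP w P).b8 → (leavesP w P).b9 → (leavesP w P).b10 → (leavesP w P).b11 →
      (leavesP w P).smallCouplings → (leavesP w P).smallFieldInductive → (leavesP w P).flowControl →
        ∀ k, k < P.K → SLaw₁₂ F N θ P k → TLaw₁₂ F N θ P k)
    (h12 : ∀ P : B12.RunParams, B15Leaf (θ.res.W P))
    (hR : ∀ (P : B12.RunParams) (k : ℕ), k < P.K → TLaw₁₂ F N θ P k → SLaw₁₂ F N θ P (k + 1))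
    (hcor3 : ∃ R : B14Cor3.ReprFamily (datumOfRecord₁₂ F N θ hP).C,
      B14Cor3.LeafH (datumOfRecord₁₂ F N θ hP).C R w.γ ∧ B14Cor3.LeafU1 (datumOfRecord₁₂ F N θ hP).C R w.γ ∧
        B14Cor3.LeafU2 (datumOfRecord₁₂ F N θ hP).C R w.γ w.ep ∧ B14Cor3.LeafL1 (datumOfRecord₁₂ F N θ hP).C R w.γ ∧
          B14Cor3.LeafL2 (datumOfRecord₁₂ F N θ hP).C R w.γ w.em)
    (hlo : BetaLowerH w.b w.γ (datumOfRecord₁₂ F N θ hP).βfun) (hhi : BetaUpperH w.βup w.γ (datumOfRecord₁₂ F N θ hP).βfun) :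
    B16.EndStatementBPrinted (datumOfRecord₁₂ F N θ hP).C := by
  obtain ⟨hrec, hn⟩ := N24_nodes₁₂_pointed θ hP hθ w hC hγ hL hup h05 h06 h07 h08 h09 h09T h10 h11 h12 hR hcor3
  exact endStatementBPrinted_of_isRecordOfRecord₁₂C_of_nodes hrec le_rfl hn (N24_betaBoundsInInterval_of_isRecordOfRecord₁₂C_of_boxH hrec hlo hhi)

/-- **THE CONSEQUENT OF ITEM K1′ `StabilityBAtRecordR12e` (rev 15, stmt-QuantumFields-19903) FROM THE POINTED CHILDREN AND THE β-BOX PAIR**, witnessed by the presentation `(θ, hP)`: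
`∃ θ' h', (θ'.ZtUnity F N ∧ θ'.SlotsNondegenerate) ∧ θ'.Admissible F N ∧ B16.EndStatementBPrinted (datumOfRecord₁₂ F N θ' h').C ∧ ∃ γ₁ > 0, ∀ γ ∈ ]0, γ₁], ∃ P, 1 ≤ P.K ∧
((datumOfRecord₁₂ F N θ' h').C P).flow.InInterval γ P.K` (general `N`; at `N := 2` the item's consequent text) — (B) by `N24_endStatementBPrinted₁₂_pointed`, the window from `hhi`
(module 26 §2), the guard `hU` DISPLAYED (K0′'s product, not produced here).  THE CLOSER'S RECIPE IN ONE SENTENCE: a guarded admissible presentation (K0′ `Record12Inhabited`), the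
children at its own objects (§1's list), and the β-box pair (β⁺ [I] p. 264; `b > 0` NODE O, UNPRINTED).  COMPOSITE: nothing is discharged.
[cite: Balaban1989LargeFieldII, Thm 1 p.355 + p.391; Balaban1988Convergent, (3.16)–(3.22) pp.268–269; Balaban1987RG1, (0.17)–(0.20) pp.255–256 and (1.22) p.264 (bookkeeping + elementary window)] -/
theorem N24_stabilityBR12e_thetaShape15_pointed (θ : Stage12Params F N) (hP : θ.Provisos₁₂ F N) (hθ : θ.Admissible F N)
    (hU : θ.ZtUnity F N ∧ θ.SlotsNondegenerate) (w : WorldP)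
    (hC : w.C = (datumOfRecord₁₂ F N θ hP).C) (hγ : 0 < w.γ ∧ w.γ ≤ θ.γ) (hL : w.L = (θ.L : ℝ))
    (hup : ∀ P, w.up P = upOfRecord₅C F N (θ.toStage5₁₂ F N) P)
    (h05 : ∀ P : B12.RunParams,
      B8LeafR (θ.res.X P).d8 (θ.res.X P).L8 (θ.res.X P).C₂ (θ.res.X P).B₁' (θ.res.X P).B₀' (θ.res.X P).B₁ (θ.res.X P).B₂ (θ.res.X P).c₁
        (θ.res.X P).inp8 (θ.res.X P).B₀β (θ.res.X P).loc8 (θ.res.X P).fam8R (θ.res.X P).lan8 (θ.res.X P).cub8 (θ.res.X P).toAxial8)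
    (h06 : ∀ P : B12.RunParams, B9LeafX (θ.res.Y P))
    (h07 : ∀ P : B12.RunParams, B11Leaf (θ.res.Z P))
    (h08 : ∀ P : B12.RunParams, ∃ (Xc : PrintedCarriersR) (I : Type) (C : B10Assembly.Consts) (T : I → B10.TowerRun),
      Nonempty (∀ i, B10Assembly.LeafSystem C (T i)) ∧ θ.res.X P = Xc.withTowerRuns10 T)
    (h09 : ∀ P : B12.RunParams, B12Sec2to5.Lemma4Printed (θ.res.X P).F12 (θ.res.X P).c12)
    (h09T : ∀ P : B12.RunParams, (leavesP w P).smallCouplings → (leavesP w P).smallFieldInductive)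
    (h10 : ∀ P : B12.RunParams, B9LeafX (θ.res.Y P) →
      (B10.Thm1PrintedCompact (θ.res.X P).runs10 ∧ B10.Thm2Printed (θ.res.X P).runs10) →
        B11Leaf (θ.res.Z P) → B12Sec2to5.Lemma4Printed (θ.res.X P).F12 (θ.res.X P).c12 →
          B13.Lemma1Printed (θ.res.X P).S13 (θ.res.X P).c13 ∧ B13.Lemma2Printed (θ.res.X P).S13 (θ.res.X P).c13 ∧
            B13.Lemma3Printed (θ.res.X P).S13 (θ.res.X P).c13)
    (h11 : ∀ P : B12.RunParams, (leavesP w P).b7 → (leavesP w P).b8 → (leavesP w P).b9 → (leavesP w P).b10 → (leavesP w P).b11 →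
      (leavesP w P).smallCouplings → (leavesP w P).smallFieldInductive → (leavesP w P).flowControl →
        ∀ k, k < P.K → SLaw₁₂ F N θ P k → TLaw₁₂ F N θ P k)
    (h12 : ∀ P : B12.RunParams, B15Leaf (θ.res.W P))
    (hR : ∀ (P : B12.RunParams) (k : ℕ), k < P.K → TLaw₁₂ F N θ P k → SLaw₁₂ F N θ P (k + 1))
    (hcor3 : ∃ R : B14Cor3.ReprFamily (datumOfRecord₁₂ F N θ hP).C,
      B14Cor3.LeafH (datumOfRecord₁₂ F N θ hP).C R w.γ ∧ B14Cor3.LeafU1 (datumOfRecord₁₂ F N θ hP).C R w.γ ∧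
        B14Cor3.LeafU2 (datumOfRecord₁₂ F N θ hP).C R w.γ w.ep ∧ B14Cor3.LeafL1 (datumOfRecord₁₂ F N θ hP).C R w.γ ∧
          B14Cor3.LeafL2 (datumOfRecord₁₂ F N θ hP).C R w.γ w.em)
    (hlo : BetaLowerH w.b w.γ (datumOfRecord₁₂ F N θ hP).βfun) (hhi : BetaUpperH w.βup w.γ (datumOfRecord₁₂ F N θ hP).βfun) :
    ∃ (θ' : Stage12Params F N) (h' : θ'.Provisos₁₂ F N), (θ'.ZtUnity F N ∧ θ'.SlotsNondegenerate) ∧ θ'.Admissible F N ∧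
      B16.EndStatementBPrinted (datumOfRecord₁₂ F N θ' h').C ∧
      ∃ γ₁ : ℝ, 0 < γ₁ ∧ ∀ γ : ℝ, 0 < γ → γ ≤ γ₁ → ∃ P : B12.RunParams, 1 ≤ P.K ∧ ((datumOfRecord₁₂ F N θ' h').C P).flow.InInterval γ P.K :=
  ⟨θ, hP, hU, hθ, N24_endStatementBPrinted₁₂_pointed θ hP hθ w hC hγ hL hup h05 h06 h07 h08 h09 h09T h10 h11 h12 hR hcor3 hlo hhi,
    N24_window_of_betaUpperH _ hγ.1 hhi⟩

end Literature.MathematicalPhysics.QuantumFieldTheory.Balaban1983to89.Node00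

end
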